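import Mathlib
import HarnessLib

/-!
# Unbiased Markov chain Monte Carlo with couplings: the estimator `H_k(X, Y)` is unbiased, has a
# finite variance and a finite expected computing time (Jacob–O'Leary–Atchadé 2020,
# Proposition 3.1, after Glynn–Rhee 2014)

HONEST FRAMING: exact (Metropolis-corrected) sampling algorithms for lattice gauge theory;
figures of merit are autocorrelation/cost numbers at stated couplings and volumes; no
continuum-physics claim.

Topic `Probability/MarkovChains` (companions: `CouplingFromThePast.lean` — exact SAMPLES from a
coupling; `MarkovianCoupling.lean`, `OptimalCoupling.lean` — the couplings; and
`Moments/RandomizedTruncation.lean` — the Rhee–Glynn randomized-truncation estimators with an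
INDEPENDENT truncation variable, of which `H_k` is the version truncated at the MEETING TIME of two
coupled chains).  PUBLISHED RESULT with our formalisation (Mathlib: Bochner / Lebesgue integral,
`eLpNorm`, Hölder, Fatou for `L²` norms); every statement proved, no named fact.

Source (READ at the locators).  P. E. Jacob, J. O'Leary, Y. F. Atchadé, *Unbiased Markov chain
Monte Carlo methods with couplings*, J. R. Stat. Soc. Ser. B 82 (2020) 543–600
[arXiv:1708.03625] [JacobOlearyAtchade2020]:
* §2.1 (the setting): "Our estimators are based on a coupled pair of Markov chains `(X_t)_{t≥0}`
  and `(Y_t)_{t≥0}`, which marginally start from `π_0` and evolve according to `P` … By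
  construction, each of the two marginal chains … has initial distribution `π_0` and transition
  kernel `P`";
* **Assumption 2.1** "As `t → ∞`, `E[h(X_t)] → E_π[h(X)]`.  Furthermore, there exists an `η > 0`
  and `D < ∞` such that `E[|h(X_t)|^{2+η}] ≤ D` for all `t ≥ 0`";
* **Assumption 2.2** "The chains are such that the meeting time `τ := inf{t ≥ 1 : X_t = Y_{t−1}}`
  satisfies `P(τ > t) ≤ C δ^t` for all `t ≥ 0`, for some constants `C < ∞` and `δ ∈ (0,1)`";
* **Assumption 2.3** "The chains stay together after meeting, i.e. `X_t = Y_{t−1}` for all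
  `t ≥ τ`";
* the estimator: "`E_π[h(X)] = E[h(X_k)] + Σ_{t=k+1}^{∞} (E[h(X_t)] − E[h(X_{t−1})])` expanding the
  limit as a telescoping sum, `= E[h(X_k)] + Σ_{t=k+1}^{∞} (E[h(X_t)] − E[h(Y_{t−1})])` since the
  chains have the same marginals, `= E[h(X_k) + Σ_{t=k+1}^{∞} (h(X_t) − h(Y_{t−1}))]` swapping the
  expectations and limit, `= E[h(X_k) + Σ_{t=k+1}^{τ−1} (h(X_t) − h(Y_{t−1}))]` since the terms
  corresponding to `t ≥ τ` are null … the estimator `H_k(X,Y) = h(X_k) + Σ_{t=k+1}^{τ−1}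
  (h(X_t) − h(Y_{t−1}))` should have expectation `E_π[h(X)]`.  This estimator requires `τ` calls
  to `P̄` … thus under Assumption 2.2 its cost has a finite expectation";
* **Proposition 3.1** "Under Assumptions 2.1–2.3, for all `k ≥ 0`, the estimator `H_k(X,Y)` has
  expectation `E_π[h(X)]`, a finite variance, and a finite expected computing time";
* its proof, §7.1: "`Δ_t = h(X_t) − h(Y_{t−1})` … `E[Δ_t²] = E[Δ_t² · 1(τ > t)]`, we can apply
  Hölder's inequality with `p = 1 + η/2`, `q = (2+η)/η` … `E[Δ_t² · 1(τ>t)] ≤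
  E[|Δ_t|^{2+η}]^{1/(1+η/2)} · (C δ^t)^{η/(2+η)}` … Minkowski's inequality to bound
  `E[|Δ_t|^{2+η}]^{1/(1+η/2)}` by a constant `C̃`, for all `t` … `E[Δ_t²] ≤ C̃ δ̃^t` … thus
  `(H_0^n(X,Y))` is Cauchy in `L_2` … its limit `H_0(X,Y)` has finite first and second moments.
  Assumption 2.1 implies that `lim_n E[H_0^n(X,Y)] = E_π[h(X)]`, by a telescopic sum argument, so
  we conclude that `E[H_0(X,Y)] = E_π[h(X)]`" ("We follow the same arguments as in
  [glynn2014exact, vihola2015unbiased]").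
Attribution as printed: "we introduce the following motivation for an unbiased estimator of
`E_π[h(X)]`, following [glynn2014exact]" = P. W. Glynn, C.-H. Rhee, *Exact estimation for Markov
chain equilibrium expectations*, J. Appl. Probab. 51A (2014) 377–389 [GlynnRhee2014] (not re-read
here; every locator below is to [JacobOlearyAtchade2020]).

Lean reading (everything on ONE probability space `(Ω, P)`; the Markov/kernel structure of §2.1
enters Proposition 3.1 only through the three assumptions and the equality of the marginal laws,
so we take exactly these as hypotheses — `Assumptions`):
* `X Y : ℕ → Ω → 𝒳` the two chains, `h : 𝒳 → ℝ`, `τ : Ω → ℕ` the meeting time (finite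
  everywhere; the printed `τ` is a.s. finite by Assumption 2.2), `target : Measure 𝒳` the law `π`
  (only `E_π[h] = ∫ h dπ` is used);
* `identDistrib t : IdentDistrib (X t) (Y t) P P` — "each of the two marginal chains has initial
  distribution `π_0` and transition kernel `P`" (same marginal law at every time);
* Assumption 2.1 = `tendsto` + `moment` (`q = 2 + η > 2`, `E‖h(X_t)‖^q ≤ D`); Assumption 2.2 =
  `tail` (`P{t < τ} ≤ C δ^t`, `δ < 1`); Assumption 2.3 = `faithful`;
* `incr h X Y t = Δ_t`, `Hk h X Y τ k = H_k(X, Y)` (a finite sum, as printed), `term … k t =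
  Δ_t 1{k < t < τ}` (so that `H_k = h(X_k) + Σ_t term_t`, `Hk_eq_add_tsum`).

Contents (all proved): `lintegral_rpow_incr_le` (Minkowski: `E|Δ_t|^q ≤ 2^{q−1}·2D`),
`lintegral_sq_incr_indicator_le` (Hölder: `E[Δ_t² 1(τ>t)] ≤ (2^q D)^{2/q} P(τ>t)^{1−2/q}`),
`lintegral_sq_incr_indicator_le_geom` (`≤ K ρ^t`, `ρ = δ^{1−2/q} < 1`), `eLpNorm_term_le`
(`‖term_t‖₂ ≤ K^{1/2} (ρ^{1/2})^t`), `eLpNorm_partialSum_le` (uniform `L²` bound of the partial sums),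
**`memLp_two_Hk`** (finite variance: `H_k ∈ L²`), `integrable_Hk`, `integral_term`
(`E[term_t] = E h(X_t) − E h(X_{t−1})` for `t > k` — same marginals + faithfulness),
**`integral_Hk`** = PROPOSITION 3.1's unbiasedness `E[H_k(X,Y)] = E_π[h(X)]`, and
**`lintegral_tau_le`** / `integrable_tau` (finite expected computing time `E τ ≤ Σ_t C δ^t < ∞`);
the §2.3 time-averaged estimator `Hkm` = `H_{k:m} = (m−k+1)⁻¹ Σ_{ℓ=k}^{m} H_ℓ` with `Hkm_self`
(`m = k`), `memLp_two_Hkm`, **`integral_Hkm`** (unbiased for `m ≥ k`); `Assumptions.of_const`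
(the hypotheses are jointly satisfiable — constant chains, a sanity check only).

Deliberate omissions / TODO: the rearranged form (2.1) of `H_{k:m}` as "MCMC average + bias
correction", Proposition 3.2 (Glivenko–Cantelli for the signed-measure estimator), §3.1's variance
representation and the efficiency comparison, and the construction of couplings `P̄` (§4) are not
formalised.

Context (cell pub-lqcd, HOME/R2-SCOPE.md cost/estimator thread): unbiasedness by coupling removes
the burn-in bias of MCMC averages at the price `E τ` (the meeting time), making independent short
replicas averageable — a cost/variance trade-off stated here exactly, with no mixing-time claim
beyond Assumptions 2.1–2.2 themselves.
-/

noncomputable section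

namespace Literature.Probability.MarkovChains

open _root_.MeasureTheory _root_.ProbabilityTheory Filter Topology Finset
open scoped ENNReal NNReal

namespace UnbiasedCoupling

variable {Ω : Type*} {𝒳 : Type*}

/-! ## The estimator -/

/-- `Δ_t = h(X_t) − h(Y_{t−1})` (`t ≥ 1`). [cite: JacobOlearyAtchade2020, §7.1 (proof of
Proposition 3.1)] -/
def incr (h : 𝒳 → ℝ) (X Y : ℕ → Ω → 𝒳) (t : ℕ) (ω : Ω) : ℝ := h (X t ω) - h (Y (t - 1) ω)

/-- **The estimator** `H_k(X, Y) = h(X_k) + Σ_{t=k+1}^{τ−1} (h(X_t) − h(Y_{t−1}))` ("the sum … is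
zero if `k + 1 > τ − 1`"). [cite: JacobOlearyAtchade2020, §2.1 (definition of `H_k(X,Y)`)] -/
def Hk (h : 𝒳 → ℝ) (X Y : ℕ → Ω → 𝒳) (τ : Ω → ℕ) (k : ℕ) (ω : Ω) : ℝ :=
  h (X k ω) + ∑ t ∈ Finset.Ioo k (τ ω), incr h X Y t ω

/-- The bias-correction terms as an infinite family: `term_t = Δ_t · 1{k < t < τ}`.
[cite: JacobOlearyAtchade2020, §2.1 ("the terms corresponding to `t ≥ τ` are null")] -/
def term (h : 𝒳 → ℝ) (X Y : ℕ → Ω → 𝒳) (τ : Ω → ℕ) (k t : ℕ) : Ω → ℝ :=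
  {ω | k < t ∧ t < τ ω}.indicator (incr h X Y t)

/-- `H_k = h(X_k) + Σ_{t ≥ 0} term_t` (a finite sum written as a series).
[cite: JacobOlearyAtchade2020, §2.1 (definition of `H_k(X,Y)`)] -/
theorem Hk_eq_add_tsum (h : 𝒳 → ℝ) (X Y : ℕ → Ω → 𝒳) (τ : Ω → ℕ) (k : ℕ) (ω : Ω) :
    Hk h X Y τ k ω = h (X k ω) + ∑' t, term h X Y τ k t ω := by
  rw [Hk, tsum_eq_sum (s := Finset.Ioo k (τ ω)) (fun t ht => ?_)]
  · congr 1
    refine Finset.sum_congr rfl fun t ht => ?_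
    rw [term, Set.indicator_of_mem (show ω ∈ {ω | k < t ∧ t < τ ω} from Finset.mem_Ioo.1 ht)]
  · rw [term, Set.indicator_of_notMem
      (show ω ∉ {ω | k < t ∧ t < τ ω} from fun h' => ht (Finset.mem_Ioo.2 h'))]

/-- The partial sums `h(X_k) + Σ_{t<n} term_t` EQUAL `H_k` as soon as `n ≥ τ` ("`H_0^n(X,Y) →
H_0(X,Y)` almost surely" — here: eventually constant). [cite: JacobOlearyAtchade2020, §7.1] -/
theorem partialSum_eq_Hk (h : 𝒳 → ℝ) (X Y : ℕ → Ω → 𝒳) (τ : Ω → ℕ) (k : ℕ) (ω : Ω) {n : ℕ}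
    (hn : τ ω ≤ n) : h (X k ω) + ∑ t ∈ range n, term h X Y τ k t ω = Hk h X Y τ k ω := by
  rw [Hk]
  congr 1
  have hterm : ∀ t, term h X Y τ k t ω = if t ∈ Finset.Ioo k (τ ω) then incr h X Y t ω else 0 := by
    intro t
    by_cases ht : t ∈ Finset.Ioo k (τ ω)
    · rw [if_pos ht, term, Set.indicator_of_mem
        (show ω ∈ {ω | k < t ∧ t < τ ω} from Finset.mem_Ioo.1 ht)]
    · rw [if_neg ht, term, Set.indicator_of_notMem
        (show ω ∉ {ω | k < t ∧ t < τ ω} from fun h' => ht (Finset.mem_Ioo.2 h'))]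
  simp_rw [hterm]
  rw [Finset.sum_ite_mem, Finset.inter_eq_right.2]
  intro t ht
  exact Finset.mem_range.2 (lt_of_lt_of_le (Finset.mem_Ioo.1 ht).2 hn)

/-- `H^n → H_k` pointwise (the sequence is eventually constant). [cite: JacobOlearyAtchade2020, §7.1
("`H_0^n(X,Y) → H_0(X,Y)` almost surely")] -/
theorem tendsto_partialSum (h : 𝒳 → ℝ) (X Y : ℕ → Ω → 𝒳) (τ : Ω → ℕ) (k : ℕ) (ω : Ω) :
    Tendsto (fun n => h (X k ω) + ∑ t ∈ range n, term h X Y τ k t ω) atTop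
      (𝓝 (Hk h X Y τ k ω)) :=
  tendsto_const_nhds.congr'
    (Filter.eventually_atTop.2 ⟨τ ω, fun _ hn => (partialSum_eq_Hk h X Y τ k ω hn).symm⟩)

/-- **The time-averaged estimator** `H_{k:m}(X,Y) = (m − k + 1)⁻¹ Σ_{ℓ=k}^{m} H_ℓ(X,Y)` ("we can
compute `H_k(X,Y)` for several values of `k` from the same realization of the coupled chains, and …
the average of these is unbiased as well"). [cite: JacobOlearyAtchade2020, §2.3 (definition of
`H_{k:m}(X,Y)`)] -/
def Hkm (h : 𝒳 → ℝ) (X Y : ℕ → Ω → 𝒳) (τ : Ω → ℕ) (k m : ℕ) (ω : Ω) : ℝ :=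
  ((m - k + 1 : ℕ) : ℝ)⁻¹ * ∑ l ∈ Finset.Icc k m, Hk h X Y τ l ω

/-- "the estimator `H_k(X,Y)` is retrieved when `m = k`". [cite: JacobOlearyAtchade2020, §2.3] -/
theorem Hkm_self (h : 𝒳 → ℝ) (X Y : ℕ → Ω → 𝒳) (τ : Ω → ℕ) (k : ℕ) :
    Hkm h X Y τ k k = Hk h X Y τ k := by
  funext ω
  simp [Hkm]

variable [MeasurableSpace Ω] [MeasurableSpace 𝒳]

/-! ## The setting and Assumptions 2.1–2.3 -/

/-- **The setting of §2.1 with Assumptions 2.1, 2.2, 2.3** for a test function `h`, two chains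
`X`, `Y` on one probability space, their meeting time `τ`, the target law `π = target`, and the
constants `q = 2 + η`, `D`, `C`, `δ`. [cite: JacobOlearyAtchade2020, §2.1 Assumptions 2.1–2.3] -/
structure Assumptions (P : Measure Ω) (h : 𝒳 → ℝ) (X Y : ℕ → Ω → 𝒳) (τ : Ω → ℕ)
    (target : Measure 𝒳) (q : ℝ) (D C δ : ℝ≥0) : Prop where
  /-- `h` is measurable. -/
  measurable_h : Measurable h
  /-- the chains are measurable processes. -/
  measurable_X : ∀ t, Measurable (X t)
  measurable_Y : ∀ t, Measurable (Y t)
  /-- "each of the two marginal chains has initial distribution `π_0` and transition kernel `P`":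
  `X_t` and `Y_t` have the same law. -/
  identDistrib : ∀ t, IdentDistrib (X t) (Y t) P P
  /-- Assumption 2.1, first part: `E[h(X_t)] → E_π[h(X)]`. -/
  tendsto : Tendsto (fun t => ∫ ω, h (X t ω) ∂P) atTop (𝓝 (∫ x, h x ∂target))
  /-- Assumption 2.1, second part: `q = 2 + η > 2` … -/
  two_lt : 2 < q
  /-- … and `E[|h(X_t)|^{2+η}] ≤ D` for all `t`. -/
  moment : ∀ t, ∫⁻ ω, ‖h (X t ω)‖ₑ ^ q ∂P ≤ D
  /-- the meeting time is a random variable. -/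
  measurable_τ : Measurable τ
  /-- Assumption 2.2: `P(τ > t) ≤ C δ^t` … -/
  tail : ∀ t : ℕ, P {ω | t < τ ω} ≤ C * (δ : ℝ≥0∞) ^ t
  /-- … with `δ ∈ (0, 1)` (only `δ < 1` is used). -/
  delta_lt_one : δ < 1
  /-- Assumption 2.3: "`X_t = Y_{t−1}` for all `t ≥ τ`". -/
  faithful : ∀ ω t, τ ω ≤ t → X t ω = Y (t - 1) ω

namespace Assumptions

variable {P : Measure Ω} {h : 𝒳 → ℝ} {X Y : ℕ → Ω → 𝒳} {τ : Ω → ℕ}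
  {target : Measure 𝒳} {q : ℝ} {D C δ : ℝ≥0}
  (A : Assumptions P h X Y τ target q D C δ)
include A

/-! ### Measurability -/

/-- `Δ_t` is measurable. [cite: JacobOlearyAtchade2020, §7.1] -/
theorem measurable_incr (t : ℕ) : Measurable (incr h X Y t) :=
  (A.measurable_h.comp (A.measurable_X t)).sub (A.measurable_h.comp (A.measurable_Y (t - 1)))

/-- `{τ > t}` is an event. [cite: JacobOlearyAtchade2020, §2.1 Assumption 2.2] -/
theorem measurableSet_lt_tau (t : ℕ) : MeasurableSet {ω | t < τ ω} :=
  A.measurable_τ ((Set.to_countable (Set.Ioi t)).measurableSet)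

/-- `{k < t < τ}` is an event. [cite: JacobOlearyAtchade2020, §2.1] -/
theorem measurableSet_term_support (k t : ℕ) : MeasurableSet {ω | k < t ∧ t < τ ω} := by
  rw [Set.setOf_and]
  exact (MeasurableSet.const (k < t)).inter (A.measurableSet_lt_tau t)

/-- `term_t` is measurable. [cite: JacobOlearyAtchade2020, §7.1] -/
theorem measurable_term (k t : ℕ) : Measurable (term h X Y τ k t) :=
  (A.measurable_incr t).indicator (A.measurableSet_term_support k t)

/-- The partial sums `H^n = h(X_k) + Σ_{t<n} term_t` are measurable.
[cite: JacobOlearyAtchade2020, §7.1] -/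
theorem measurable_partialSum (k n : ℕ) :
    Measurable fun ω => h (X k ω) + ∑ t ∈ range n, term h X Y τ k t ω :=
  (A.measurable_h.comp (A.measurable_X k)).add
    (Finset.measurable_sum _ fun t _ => A.measurable_term k t)

/-- `H_k` is measurable (a pointwise limit of measurable partial sums).
[cite: JacobOlearyAtchade2020, §7.1] -/
theorem measurable_Hk (k : ℕ) : Measurable (Hk h X Y τ k) :=
  measurable_of_tendsto_metrizable (fun n => A.measurable_partialSum k n)
    (tendsto_pi_nhds.2 fun ω => tendsto_partialSum h X Y τ k ω)

/-! ### Step 1 (Minkowski): `E|Δ_t|^q ≤ 2^{q−1} · 2D` -/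

/-- `q > 2 ≥ 1`, `q > 0` bookkeeping. [cite: JacobOlearyAtchade2020, §2.1 Assumption 2.1] -/
theorem q_pos : 0 < q := lt_trans two_pos A.two_lt

/-- The moment bound transfers to `Y`: `E‖h(Y_t)‖^q = E‖h(X_t)‖^q ≤ D` (same marginals).
[cite: JacobOlearyAtchade2020, §7.1 ("use Assumption 2.1 together with Minkowski's inequality")] -/
theorem lintegral_rpow_Y_le (t : ℕ) : ∫⁻ ω, ‖h (Y t ω)‖ₑ ^ q ∂P ≤ D := by
  have hu : Measurable fun x : 𝒳 => ‖h x‖ₑ ^ q := A.measurable_h.enorm.pow_const q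
  have e : ∫⁻ ω, ‖h (X t ω)‖ₑ ^ q ∂P = ∫⁻ ω, ‖h (Y t ω)‖ₑ ^ q ∂P :=
    ((A.identDistrib t).comp hu).lintegral_eq
  rw [← e]
  exact A.moment t

/-- **Minkowski step**: `E|Δ_t|^{q} ≤ 2^{q−1} (E|h(X_t)|^q + E|h(Y_{t−1})|^q) ≤ 2^{q−1} · 2D`.
[cite: JacobOlearyAtchade2020, §7.1] -/
theorem lintegral_rpow_incr_le (t : ℕ) :
    ∫⁻ ω, ‖incr h X Y t ω‖ₑ ^ q ∂P ≤ 2 ^ (q - 1) * (D + D) := by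
  have hq1 : 1 ≤ q := le_trans one_le_two A.two_lt.le
  calc ∫⁻ ω, ‖incr h X Y t ω‖ₑ ^ q ∂P
      ≤ ∫⁻ ω, 2 ^ (q - 1) * (‖h (X t ω)‖ₑ ^ q + ‖h (Y (t - 1) ω)‖ₑ ^ q) ∂P := by
        refine lintegral_mono fun ω => ?_
        calc ‖incr h X Y t ω‖ₑ ^ q ≤ (‖h (X t ω)‖ₑ + ‖h (Y (t - 1) ω)‖ₑ) ^ q :=
              ENNReal.rpow_le_rpow enorm_sub_le A.q_pos.le
          _ ≤ 2 ^ (q - 1) * (‖h (X t ω)‖ₑ ^ q + ‖h (Y (t - 1) ω)‖ₑ ^ q) :=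
              ENNReal.rpow_add_le_mul_rpow_add_rpow _ _ hq1
    _ = 2 ^ (q - 1) * (∫⁻ ω, ‖h (X t ω)‖ₑ ^ q ∂P + ∫⁻ ω, ‖h (Y (t - 1) ω)‖ₑ ^ q ∂P) := by
        have hmX : Measurable fun ω => ‖h (X t ω)‖ₑ ^ q :=
          (A.measurable_h.comp (A.measurable_X t)).enorm.pow_const q
        have hmY : Measurable fun ω => ‖h (Y (t - 1) ω)‖ₑ ^ q :=
          (A.measurable_h.comp (A.measurable_Y (t - 1))).enorm.pow_const q
        have hsum : Measurable fun ω => ‖h (X t ω)‖ₑ ^ q + ‖h (Y (t - 1) ω)‖ₑ ^ q := hmX.add hmY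
        rw [lintegral_const_mul _ hsum, lintegral_add_left hmX]
    _ ≤ 2 ^ (q - 1) * (D + D) := by
        gcongr
        · exact A.moment t
        · exact A.lintegral_rpow_Y_le (t - 1)

/-! ### Step 2 (Hölder): `E[Δ_t² 1(τ > t)] ≤ (2^{q−1}·2D)^{2/q} · P(τ > t)^{1 − 2/q}` -/

/-- **Hölder step** with `p = q/2 = 1 + η/2` and `p' = q/(q−2) = (2+η)/η`:
`E[Δ_t² · 1(τ>t)] ≤ E[|Δ_t|^{q}]^{2/q} · P(τ>t)^{1−2/q}`.
[cite: JacobOlearyAtchade2020, §7.1 (the Hölder display)] -/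
theorem lintegral_sq_incr_indicator_le (t : ℕ) :
    ∫⁻ ω, ‖incr h X Y t ω‖ₑ ^ (2 : ℝ) * {ω | t < τ ω}.indicator 1 ω ∂P ≤
      (2 ^ (q - 1) * ((D : ℝ≥0∞) + D)) ^ (2 / q) * P {ω | t < τ ω} ^ (1 - 2 / q) := by
  have hq := A.two_lt
  have hq0 : q ≠ 0 := A.q_pos.ne'
  -- the conjugate exponents `p = q/2 > 1`, `p' = q/(q−2)`
  have hp : 1 < q / 2 := by rw [lt_div_iff₀ two_pos]; linarith
  have hpq : (q / 2).HolderConjugate (q / (q - 2)) := by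
    have h := Real.HolderConjugate.conjExponent hp
    have e : (q / 2).conjExponent = q / (q - 2) := by
      rw [Real.conjExponent]
      have : q - 2 ≠ 0 := by linarith
      field_simp
    rwa [e] at h
  have hf : AEMeasurable (fun ω => ‖incr h X Y t ω‖ₑ ^ (2 : ℝ)) P :=
    ((A.measurable_incr t).enorm.pow_const _).aemeasurable
  have hg : AEMeasurable ({ω | t < τ ω}.indicator (1 : Ω → ℝ≥0∞)) P :=
    (measurable_one.indicator (A.measurableSet_lt_tau t)).aemeasurable
  have H := ENNReal.lintegral_mul_le_Lp_mul_Lq P hpq hf hg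
  -- rewrite the three integrals
  have e1 : ∀ ω, (‖incr h X Y t ω‖ₑ ^ (2 : ℝ)) ^ (q / 2) = ‖incr h X Y t ω‖ₑ ^ q := by
    intro ω
    rw [← ENNReal.rpow_mul]
    congr 1
    field_simp
  have e2 : ∀ ω, ({ω | t < τ ω}.indicator (1 : Ω → ℝ≥0∞) ω) ^ (q / (q - 2)) =
      {ω | t < τ ω}.indicator (1 : Ω → ℝ≥0∞) ω := by
    intro ω
    have hpos : 0 < q / (q - 2) := div_pos A.q_pos (by linarith)
    by_cases hω : ω ∈ {ω | t < τ ω}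
    · rw [Set.indicator_of_mem hω, Pi.one_apply, ENNReal.one_rpow]
    · rw [Set.indicator_of_notMem hω, ENNReal.zero_rpow_of_pos hpos]
  have e3 : (1 : ℝ) / (q / 2) = 2 / q := by field_simp
  have e4 : (1 : ℝ) / (q / (q - 2)) = 1 - 2 / q := by
    have : q - 2 ≠ 0 := by linarith
    field_simp
  simp only [Pi.mul_apply, e1, e2, e3, e4, lintegral_indicator_one (A.measurableSet_lt_tau t)] at H
  refine H.trans ?_
  gcongr
  · exact A.lintegral_rpow_incr_le t

/-- The rate `ρ = δ^{1 − 2/q} = δ̃ < 1` ("Defining `δ̃ = δ^{η/(2+η)} ∈ (0,1)`").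
[cite: JacobOlearyAtchade2020, §7.1] -/
def rate (_ : Assumptions P h X Y τ target q D C δ) : ℝ≥0∞ := (δ : ℝ≥0∞) ^ (1 - 2 / q)

/-- The constant `K = (2^{q−1}·2D)^{2/q} C^{1−2/q}` ("`C̃`"). [cite: JacobOlearyAtchade2020, §7.1] -/
def const (_ : Assumptions P h X Y τ target q D C δ) : ℝ≥0∞ :=
  (2 ^ (q - 1) * ((D : ℝ≥0∞) + D)) ^ (2 / q) * (C : ℝ≥0∞) ^ (1 - 2 / q)

/-- `0 < 1 − 2/q`. [cite: JacobOlearyAtchade2020, §7.1] -/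
theorem exponent_pos : 0 < 1 - 2 / q := by
  have hq := A.two_lt
  rw [sub_pos, div_lt_one A.q_pos]
  exact hq

/-- `ρ < 1`. [cite: JacobOlearyAtchade2020, §7.1 ("`δ̃ ∈ (0,1)`")] -/
theorem rate_lt_one : A.rate < 1 :=
  ENNReal.rpow_lt_one (by exact_mod_cast A.delta_lt_one) A.exponent_pos

/-- `K < ∞`. [cite: JacobOlearyAtchade2020, §7.1] -/
theorem const_lt_top : A.const < ∞ := by
  have h1 : (2 : ℝ≥0∞) ^ (q - 1) * ((D : ℝ≥0∞) + D) < ∞ :=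
    ENNReal.mul_lt_top (ENNReal.rpow_lt_top_of_nonneg (by linarith [A.two_lt]) ENNReal.ofNat_ne_top)
      (by simp)
  have hdiv : 0 ≤ 2 / q := div_nonneg zero_le_two A.q_pos.le
  exact ENNReal.mul_lt_top (ENNReal.rpow_lt_top_of_nonneg hdiv h1.ne)
    (ENNReal.rpow_lt_top_of_nonneg A.exponent_pos.le ENNReal.coe_ne_top)

/-- **Geometric decay of the squared increments**: `E[Δ_t² 1(τ>t)] ≤ K ρ^t` ("gives the bound
`E[Δ_t²] ≤ C̃ δ̃^t` for all `t ≥ 0`"). [cite: JacobOlearyAtchade2020, §7.1] -/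
theorem lintegral_sq_incr_indicator_le_geom (t : ℕ) :
    ∫⁻ ω, ‖incr h X Y t ω‖ₑ ^ (2 : ℝ) * {ω | t < τ ω}.indicator 1 ω ∂P ≤ A.const * A.rate ^ t := by
  refine (A.lintegral_sq_incr_indicator_le t).trans ?_
  have hs := A.exponent_pos.le
  calc (2 ^ (q - 1) * ((D : ℝ≥0∞) + D)) ^ (2 / q) * P {ω | t < τ ω} ^ (1 - 2 / q)
      ≤ (2 ^ (q - 1) * ((D : ℝ≥0∞) + D)) ^ (2 / q) * ((C : ℝ≥0∞) * (δ : ℝ≥0∞) ^ t) ^ (1 - 2 / q) := by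
        gcongr
        exact A.tail t
    _ = A.const * A.rate ^ t := by
        rw [ENNReal.mul_rpow_of_nonneg _ _ hs, const, rate, ← mul_assoc, ← ENNReal.rpow_natCast,
          ← ENNReal.rpow_mul, ← ENNReal.rpow_natCast, ← ENNReal.rpow_mul, mul_comm (t : ℝ)]

/-! ### Step 3: `L²` bounds — `‖term_t‖₂ ≤ K^{1/2} (ρ^{1/2})^t`, uniformly bounded partial sums -/

/-- `‖term_t‖_{L²} ≤ (K ρ^t)^{1/2} = K^{1/2} (ρ^{1/2})^t`. [cite: JacobOlearyAtchade2020, §7.1] -/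
theorem eLpNorm_term_le (k t : ℕ) :
    eLpNorm (term h X Y τ k t) 2 P ≤ A.const ^ (1 / 2 : ℝ) * (A.rate ^ (1 / 2 : ℝ)) ^ t := by
  rw [eLpNorm_eq_lintegral_rpow_enorm_toReal two_ne_zero ENNReal.ofNat_ne_top, ENNReal.toReal_ofNat]
  have hle : ∫⁻ ω, ‖term h X Y τ k t ω‖ₑ ^ (2 : ℝ) ∂P ≤
      ∫⁻ ω, ‖incr h X Y t ω‖ₑ ^ (2 : ℝ) * {ω | t < τ ω}.indicator 1 ω ∂P := by
    refine lintegral_mono fun ω => ?_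
    by_cases hω : k < t ∧ t < τ ω
    · rw [term, Set.indicator_of_mem (show ω ∈ {ω | k < t ∧ t < τ ω} from hω),
        Set.indicator_of_mem (show ω ∈ {ω | t < τ ω} from hω.2), Pi.one_apply, mul_one]
    · rw [term, Set.indicator_of_notMem (show ω ∉ {ω | k < t ∧ t < τ ω} from hω), enorm_zero,
        ENNReal.zero_rpow_of_pos two_pos]
      exact bot_le
  calc (∫⁻ ω, ‖term h X Y τ k t ω‖ₑ ^ (2 : ℝ) ∂P) ^ (1 / 2 : ℝ)
      ≤ (A.const * A.rate ^ t) ^ (1 / 2 : ℝ) :=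
        ENNReal.rpow_le_rpow (hle.trans (A.lintegral_sq_incr_indicator_le_geom t)) (by norm_num)
    _ = A.const ^ (1 / 2 : ℝ) * (A.rate ^ (1 / 2 : ℝ)) ^ t := by
        rw [ENNReal.mul_rpow_of_nonneg _ _ (by norm_num), ← ENNReal.rpow_natCast,
          ← ENNReal.rpow_mul, ← ENNReal.rpow_natCast (A.rate ^ (1 / 2 : ℝ)), ← ENNReal.rpow_mul,
          mul_comm (t : ℝ)]

/-- `ρ^{1/2} < 1`. [cite: JacobOlearyAtchade2020, §7.1] -/
theorem sqrt_rate_lt_one : A.rate ^ (1 / 2 : ℝ) < 1 :=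
  ENNReal.rpow_lt_one A.rate_lt_one (by norm_num)

/-- The series of `L²` norms converges: `Σ_t ‖term_t‖₂ ≤ K^{1/2} / (1 − ρ^{1/2}) < ∞` ("`(H_0^n)`
is Cauchy in `L_2`"). [cite: JacobOlearyAtchade2020, §7.1] -/
theorem tsum_eLpNorm_term_le (k : ℕ) :
    ∑' t, eLpNorm (term h X Y τ k t) 2 P ≤ A.const ^ (1 / 2 : ℝ) * (1 - A.rate ^ (1 / 2 : ℝ))⁻¹ := by
  calc ∑' t, eLpNorm (term h X Y τ k t) 2 P
      ≤ ∑' t : ℕ, A.const ^ (1 / 2 : ℝ) * (A.rate ^ (1 / 2 : ℝ)) ^ t :=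
        ENNReal.tsum_le_tsum fun t => A.eLpNorm_term_le k t
    _ = A.const ^ (1 / 2 : ℝ) * (1 - A.rate ^ (1 / 2 : ℝ))⁻¹ := by
        rw [ENNReal.tsum_mul_left, ENNReal.tsum_geometric]

/-- **Uniform `L²` bound of the partial sums** `H^n = h(X_k) + Σ_{t<n} term_t`:
`‖H^n‖₂ ≤ ‖h(X_k)‖₂ + Σ_t ‖term_t‖₂ ≤ B`. [cite: JacobOlearyAtchade2020, §7.1] -/
theorem eLpNorm_partialSum_le (k n : ℕ) :
    eLpNorm (fun ω => h (X k ω) + ∑ t ∈ range n, term h X Y τ k t ω) 2 P ≤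
      eLpNorm (fun ω => h (X k ω)) 2 P + A.const ^ (1 / 2 : ℝ) * (1 - A.rate ^ (1 / 2 : ℝ))⁻¹ := by
  have hmeas0 : AEStronglyMeasurable (fun ω => h (X k ω)) P :=
    (A.measurable_h.comp (A.measurable_X k)).aestronglyMeasurable
  have hmeasS : AEStronglyMeasurable (∑ t ∈ range n, term h X Y τ k t) P :=
    Finset.aestronglyMeasurable_sum _ fun t _ => (A.measurable_term k t).aestronglyMeasurable
  have e : (fun ω => h (X k ω) + ∑ t ∈ range n, term h X Y τ k t ω) =
      (fun ω => h (X k ω)) + ∑ t ∈ range n, term h X Y τ k t := by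
    funext ω
    simp only [Pi.add_apply, Finset.sum_apply]
  rw [e]
  refine (eLpNorm_add_le hmeas0 hmeasS one_le_two).trans ?_
  gcongr
  refine (eLpNorm_sum_le (fun t _ => (A.measurable_term k t).aestronglyMeasurable) one_le_two).trans ?_
  exact (ENNReal.sum_le_tsum _).trans (A.tsum_eLpNorm_term_le k)

/-! ### Proposition 3.1: finite expected computing time -/

/-- **PROPOSITION 3.1, "a finite expected computing time"**: `E[τ] = Σ_{t≥0} P(τ > t) ≤
Σ_t C δ^t = C/(1−δ) < ∞` ("This estimator requires `τ` calls to `P̄` … thus under Assumption 2.2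
its cost has a finite expectation"). [cite: JacobOlearyAtchade2020, §2.1 and §3 Proposition 3.1] -/
theorem lintegral_tau_le : ∫⁻ ω, (τ ω : ℝ≥0∞) ∂P ≤ C * (1 - (δ : ℝ≥0∞))⁻¹ := by
  -- `τ = Σ_t 1(t < τ)`
  have e : ∀ ω, (τ ω : ℝ≥0∞) = ∑' t : ℕ, {ω | t < τ ω}.indicator 1 ω := by
    intro ω
    rw [tsum_eq_sum (s := range (τ ω)) (fun t ht => ?_)]
    · rw [Finset.sum_congr rfl fun t ht => Set.indicator_of_mem
        (show ω ∈ {ω | t < τ ω} from Finset.mem_range.1 ht) (1 : Ω → ℝ≥0∞)]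
      simp
    · exact Set.indicator_of_notMem (show ω ∉ {ω | t < τ ω} from
        fun h' => ht (Finset.mem_range.2 h')) (1 : Ω → ℝ≥0∞)
  simp_rw [e]
  rw [lintegral_tsum fun t => (measurable_one.indicator (A.measurableSet_lt_tau t)).aemeasurable]
  simp_rw [lintegral_indicator_one (A.measurableSet_lt_tau _)]
  calc ∑' t, P {ω | t < τ ω} ≤ ∑' t : ℕ, (C : ℝ≥0∞) * (δ : ℝ≥0∞) ^ t :=
        ENNReal.tsum_le_tsum A.tail
    _ = C * (1 - (δ : ℝ≥0∞))⁻¹ := by rw [ENNReal.tsum_mul_left, ENNReal.tsum_geometric]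

/-- The meeting time is integrable: `E τ < ∞`. [cite: JacobOlearyAtchade2020, §3 Proposition 3.1] -/
theorem integrable_tau : Integrable (fun ω => (τ ω : ℝ)) P := by
  have hmeas : AEStronglyMeasurable (fun ω => (τ ω : ℝ)) P :=
    (measurable_from_nat.comp A.measurable_τ).aestronglyMeasurable
  refine ⟨hmeas, ?_⟩
  rw [hasFiniteIntegral_iff_enorm]
  have e : ∀ ω, ‖(τ ω : ℝ)‖ₑ = (τ ω : ℝ≥0∞) := fun ω => by
    rw [Real.enorm_eq_ofReal (Nat.cast_nonneg _), ENNReal.ofReal_natCast]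
  simp_rw [e]
  refine lt_of_le_of_lt A.lintegral_tau_le (ENNReal.mul_lt_top ENNReal.coe_lt_top ?_)
  rw [ENNReal.inv_lt_top, tsub_pos_iff_lt]
  exact_mod_cast A.delta_lt_one

/-! ### On the probability space: `L²`, integrability, unbiasedness -/

variable [IsProbabilityMeasure P]

/-- The bound `B = ‖h(X_k)‖₂ + K^{1/2}/(1 − ρ^{1/2})` is finite. [cite: JacobOlearyAtchade2020, §7.1] -/
theorem bound_lt_top (k : ℕ) :
    eLpNorm (fun ω => h (X k ω)) 2 P + A.const ^ (1 / 2 : ℝ) * (1 - A.rate ^ (1 / 2 : ℝ))⁻¹ < ∞ := by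
  refine ENNReal.add_lt_top.2 ⟨?_, ?_⟩
  · -- `‖h(X_k)‖₂ ≤ ‖h(X_k)‖_q ≤ D^{1/q} < ∞` on a probability space
    have hq := A.two_lt
    have hmeas : AEStronglyMeasurable (fun ω => h (X k ω)) P :=
      (A.measurable_h.comp (A.measurable_X k)).aestronglyMeasurable
    have h2q : (2 : ℝ≥0∞) ≤ ENNReal.ofReal q := by
      rw [show (2 : ℝ≥0∞) = ENNReal.ofReal 2 by simp]
      exact ENNReal.ofReal_le_ofReal hq.le
    refine lt_of_le_of_lt (eLpNorm_le_eLpNorm_of_exponent_le h2q hmeas) ?_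
    rw [eLpNorm_eq_lintegral_rpow_enorm_toReal (by simp [A.q_pos]) ENNReal.ofReal_ne_top,
      ENNReal.toReal_ofReal A.q_pos.le]
    refine ENNReal.rpow_lt_top_of_nonneg (div_nonneg zero_le_one A.q_pos.le) ?_
    exact (lt_of_le_of_lt (A.moment k) ENNReal.coe_lt_top).ne
  · refine ENNReal.mul_lt_top (ENNReal.rpow_lt_top_of_nonneg (by norm_num) A.const_lt_top.ne) ?_
    rw [ENNReal.inv_lt_top, tsub_pos_iff_lt]
    exact A.sqrt_rate_lt_one

/-! ### Proposition 3.1: finite variance -/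

/-- **PROPOSITION 3.1, "a finite variance"**: `H_k(X,Y) ∈ L²(P)` ("its limit `H_0(X,Y)` has finite
first and second moments"; here by Fatou's lemma for `L²` norms along the eventually-constant
partial sums). [cite: JacobOlearyAtchade2020, §3 Proposition 3.1] -/
theorem memLp_two_Hk (k : ℕ) : MemLp (Hk h X Y τ k) 2 P := by
  refine ⟨(A.measurable_Hk k).aestronglyMeasurable, ?_⟩
  have hlim : ∀ᵐ ω ∂P, Tendsto (fun n => h (X k ω) + ∑ t ∈ range n, term h X Y τ k t ω) atTop
      (𝓝 (Hk h X Y τ k ω)) :=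
    ae_of_all _ fun ω => tendsto_partialSum h X Y τ k ω
  have hF := Lp.eLpNorm_lim_le_liminf_eLpNorm (p := 2) (μ := P)
    (fun n => (A.measurable_partialSum k n).aestronglyMeasurable) (Hk h X Y τ k) hlim
  refine lt_of_le_of_lt (hF.trans ?_) (A.bound_lt_top k)
  refine Filter.liminf_le_of_frequently_le' (Filter.Frequently.of_forall fun n => ?_)
  exact A.eLpNorm_partialSum_le k n

/-- `H_k(X,Y)` is integrable ("finite first … moments"). [cite: JacobOlearyAtchade2020, §3
Proposition 3.1] -/
theorem integrable_Hk (k : ℕ) : Integrable (Hk h X Y τ k) P :=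
  (A.memLp_two_Hk k).integrable one_le_two

/-! ### Proposition 3.1: unbiasedness -/

/-- `h(X_t)` is integrable (from the `q`-moment bound). [cite: JacobOlearyAtchade2020, §2.1
Assumption 2.1] -/
theorem integrable_hX (t : ℕ) : Integrable (fun ω => h (X t ω)) P := by
  have hq := A.two_lt
  have hmeas : AEStronglyMeasurable (fun ω => h (X t ω)) P :=
    (A.measurable_h.comp (A.measurable_X t)).aestronglyMeasurable
  refine MemLp.integrable (q := ENNReal.ofReal q) ?_ ⟨hmeas, ?_⟩
  · rw [show (1 : ℝ≥0∞) = ENNReal.ofReal 1 by simp]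
    exact ENNReal.ofReal_le_ofReal (by linarith)
  · rw [eLpNorm_eq_lintegral_rpow_enorm_toReal (by simp [A.q_pos]) ENNReal.ofReal_ne_top,
      ENNReal.toReal_ofReal A.q_pos.le]
    refine ENNReal.rpow_lt_top_of_nonneg (div_nonneg zero_le_one A.q_pos.le) ?_
    exact (lt_of_le_of_lt (A.moment t) ENNReal.coe_lt_top).ne

/-- `h(Y_t)` is integrable (same law as `h(X_t)`). [cite: JacobOlearyAtchade2020, §2.1] -/
theorem integrable_hY (t : ℕ) : Integrable (fun ω => h (Y t ω)) P :=
  ((A.identDistrib t).comp A.measurable_h).integrable_iff.mp (A.integrable_hX t)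

/-- **"since the terms corresponding to `t ≥ τ` are null" + "since the chains have the same
marginals"**: for `t > k`, `E[term_t] = E[Δ_t] = E h(X_t) − E h(Y_{t−1}) = E h(X_t) − E h(X_{t−1})`;
for `t ≤ k`, `term_t = 0`. [cite: JacobOlearyAtchade2020, §2.1 (the telescoping display)] -/
theorem integral_term (k t : ℕ) :
    ∫ ω, term h X Y τ k t ω ∂P =
      if k < t then ∫ ω, h (X t ω) ∂P - ∫ ω, h (X (t - 1) ω) ∂P else 0 := by
  by_cases hkt : k < t
  · rw [if_pos hkt]
    -- `term_t = Δ_t` everywhere: on `{τ ≤ t}` faithfulness gives `Δ_t = 0`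
    have e : term h X Y τ k t = incr h X Y t := by
      funext ω
      by_cases hω : t < τ ω
      · rw [term, Set.indicator_of_mem (show ω ∈ {ω | k < t ∧ t < τ ω} from ⟨hkt, hω⟩)]
      · rw [term, Set.indicator_of_notMem (show ω ∉ {ω | k < t ∧ t < τ ω} from fun h' => hω h'.2),
          incr, A.faithful ω t (not_lt.1 hω), sub_self]
    rw [e]
    have eY : ∫ ω, h (X (t - 1) ω) ∂P = ∫ ω, h (Y (t - 1) ω) ∂P :=
      ((A.identDistrib (t - 1)).comp A.measurable_h).integral_eq
    rw [eY]
    exact integral_sub (A.integrable_hX t) (A.integrable_hY (t - 1))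
  · rw [if_neg hkt]
    have e : term h X Y τ k t = fun _ => 0 := by
      funext ω
      rw [term, Set.indicator_of_notMem (show ω ∉ {ω | k < t ∧ t < τ ω} from fun h' => hkt h'.1)]
    rw [e, integral_zero]

/-- The `L¹` norms of the terms are summable: `Σ_t E|term_t| ≤ Σ_t ‖term_t‖₂ < ∞` ("swapping the
expectations and limit" is licit). [cite: JacobOlearyAtchade2020, §7.1] -/
theorem tsum_lintegral_enorm_term_ne_top (k : ℕ) :
    ∑' t, ∫⁻ ω, ‖term h X Y τ k t ω‖ₑ ∂P ≠ ∞ := by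
  have hle : ∀ t, ∫⁻ ω, ‖term h X Y τ k t ω‖ₑ ∂P ≤ eLpNorm (term h X Y τ k t) 2 P := by
    intro t
    rw [← eLpNorm_one_eq_lintegral_enorm]
    exact eLpNorm_le_eLpNorm_of_exponent_le one_le_two
      (A.measurable_term k t).aestronglyMeasurable
  refine (lt_of_le_of_lt ((ENNReal.tsum_le_tsum hle).trans (A.tsum_eLpNorm_term_le k)) ?_).ne
  exact lt_of_le_of_lt le_add_self (A.bound_lt_top k)

/-- The telescoping series: `Σ_t E[term_t] = E_π[h] − E[h(X_k)]` ("expanding the limit as a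
telescoping sum"). [cite: JacobOlearyAtchade2020, §2.1 (the telescoping display) and §7.1
("`lim_n E[H_0^n(X,Y)] = E_π[h(X)]`, by a telescopic sum argument")] -/
theorem hasSum_integral_term (k : ℕ) :
    HasSum (fun t => ∫ ω, term h X Y τ k t ω ∂P) (∫ x, h x ∂target - ∫ ω, h (X k ω) ∂P) := by
  set m : ℕ → ℝ := fun t => ∫ ω, h (X t ω) ∂P with hm
  -- summability from the `L¹` bounds
  have hsum : Summable fun t => ∫ ω, term h X Y τ k t ω ∂P := by
    refine Summable.of_norm_bounded (g := fun t => (∫⁻ ω, ‖term h X Y τ k t ω‖ₑ ∂P).toReal) ?_ ?_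
    · exact ENNReal.summable_toReal (A.tsum_lintegral_enorm_term_ne_top k)
    · intro t
      rw [← integral_norm_eq_lintegral_enorm (A.measurable_term k t).aestronglyMeasurable]
      exact norm_integral_le_integral_norm _
  rw [hsum.hasSum_iff_tendsto_nat]
  -- partial sums: `Σ_{t<n} E[term_t] = m(n−1) − m(k)` for `n ≥ k+1`
  have hpart : ∀ n, k + 1 ≤ n →
      ∑ t ∈ range n, ∫ ω, term h X Y τ k t ω ∂P = m (n - 1) - m k := by
    intro n hn
    induction n with
    | zero => exact absurd hn (by omega)
    | succ n ih =>
      rw [Finset.sum_range_succ, A.integral_term k n]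
      rcases Nat.lt_or_ge k n with hlt | hge
      · rw [ih (by omega), if_pos hlt]
        simp only [hm, Nat.add_sub_cancel]
        have : n - 1 + 1 = n := by omega
        ring_nf
      · have hkn : n = k := by omega
        subst hkn
        rw [if_neg (lt_irrefl _), add_zero]
        have h0 : ∀ t ∈ range n, ∫ ω, term h X Y τ n t ω ∂P = 0 := by
          intro t ht
          rw [A.integral_term n t, if_neg (not_lt.2 (Finset.mem_range.1 ht).le)]
        rw [Finset.sum_eq_zero h0]
        simp [hm]
  have hlim : Tendsto (fun n => m (n - 1) - m k) atTop (𝓝 (∫ x, h x ∂target - m k)) :=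
    (A.tendsto.comp (tendsto_sub_atTop_nat 1)).sub_const _
  refine hlim.congr' ?_
  exact Filter.eventually_atTop.2 ⟨k + 1, fun n hn => (hpart n hn).symm⟩

/-- **PROPOSITION 3.1, "has expectation `E_π[h(X)]`"** (Jacob–O'Leary–Atchadé; Glynn–Rhee): under
Assumptions 2.1–2.3, for every `k ≥ 0`, `E[H_k(X, Y)] = E_π[h(X)]`.
[cite: JacobOlearyAtchade2020, §3 Proposition 3.1] -/
theorem integral_Hk (k : ℕ) : ∫ ω, Hk h X Y τ k ω ∂P = ∫ x, h x ∂target := by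
  have e : Hk h X Y τ k = fun ω => h (X k ω) + ∑' t, term h X Y τ k t ω :=
    funext fun ω => Hk_eq_add_tsum h X Y τ k ω
  have hint : Integrable (fun ω => ∑' t, term h X Y τ k t ω) P := by
    have e2 : (fun ω => ∑' t, term h X Y τ k t ω) = fun ω => Hk h X Y τ k ω - h (X k ω) := by
      funext ω
      rw [Hk_eq_add_tsum, add_sub_cancel_left]
    rw [e2]
    exact (A.integrable_Hk k).sub (A.integrable_hX k)
  rw [e, integral_add (A.integrable_hX k) hint,
    integral_tsum (fun t => (A.measurable_term k t).aestronglyMeasurable)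
      (A.tsum_lintegral_enorm_term_ne_top k),
    (A.hasSum_integral_term k).tsum_eq]
  ring

/-! ### The time-averaged estimator `H_{k:m}` ("extends directly to `H_{k:m}(X,Y)`") -/

/-- `H_{k:m} ∈ L²` (finite variance). [cite: JacobOlearyAtchade2020, §3 ("our main result for the
estimator `H_k(X,Y)`, which extends directly to `H_{k:m}(X,Y)`")] -/
theorem memLp_two_Hkm (k m : ℕ) : MemLp (Hkm h X Y τ k m) 2 P :=
  (memLp_finsetSum _ fun l _ => A.memLp_two_Hk l).const_mul _

/-- **Unbiasedness of the time-averaged estimator**: `E[H_{k:m}(X,Y)] = E_π[h(X)]` for `m ≥ k`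
("the average of these is unbiased as well"). [cite: JacobOlearyAtchade2020, §2.3 and §3
Proposition 3.1] -/
theorem integral_Hkm {k m : ℕ} (hkm : k ≤ m) : ∫ ω, Hkm h X Y τ k m ω ∂P = ∫ x, h x ∂target := by
  simp only [Hkm]
  rw [integral_const_mul, integral_finsetSum _ fun l _ => A.integrable_Hk l]
  simp_rw [A.integral_Hk]
  rw [Finset.sum_const, Nat.card_Icc, nsmul_eq_mul, ← mul_assoc]
  have hn : ((m - k + 1 : ℕ) : ℝ) ≠ 0 := by positivity
  rw [show m + 1 - k = m - k + 1 by omega, inv_mul_cancel₀ hn, one_mul]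

end Assumptions

/-! ### Non-vacuity of the hypotheses -/

/-- The assumptions are jointly satisfiable (sanity check, not in the source): two copies of the
constant chain at `x₀` — same marginals, meeting time `τ = 0`, target `δ_{x₀}`, `q = 3`,
`D = ‖h(x₀)‖³`, `C = δ = 0`. [cite: JacobOlearyAtchade2020, §2.1 Assumptions 2.1–2.3] -/
theorem Assumptions.of_const (P : Measure Ω) [IsProbabilityMeasure P] {h : 𝒳 → ℝ}
    (hh : Measurable h) (x₀ : 𝒳) :
    Assumptions P h (fun _ _ => x₀) (fun _ _ => x₀) (fun _ => 0) (Measure.dirac x₀) 3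
      (‖h x₀‖₊ ^ 3) 0 0 where
  measurable_h := hh
  measurable_X := fun _ => measurable_const
  measurable_Y := fun _ => measurable_const
  identDistrib := fun _ => IdentDistrib.refl measurable_const.aemeasurable
  tendsto := by
    have e : (fun _ : ℕ => ∫ _ω, h x₀ ∂P) = fun _ => ∫ x, h x ∂(Measure.dirac x₀) := by
      funext
      rw [integral_const, integral_dirac' _ _ hh.stronglyMeasurable]
      simp
    rw [e]
    exact tendsto_const_nhds
  two_lt := by norm_num
  moment := fun _ => by
    rw [lintegral_const, measure_univ, mul_one, show (3 : ℝ) = ((3 : ℕ) : ℝ) by norm_num,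
      ENNReal.rpow_natCast, enorm_eq_nnnorm, ENNReal.coe_pow]
  measurable_τ := measurable_const
  tail := fun t => by simp
  delta_lt_one := zero_lt_one
  faithful := fun _ _ _ => rfl

end UnbiasedCoupling

end Literature.Probability.MarkovChains

end
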